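import Mathlib
import Literature.NumberTheory.LFunctions.Zhang2022.TypedSection17
import Literature.NumberTheory.LFunctions.Zhang2022.TypedSection13Edges
import Literature.NumberTheory.LFunctions.Zhang2022.SkeletonWindowPowers
import HarnessLib

/-!
# Zhang (2022) §17 (17.7): the Ψ₁ → Ψ extension error, weighted form — the twist `(p_ψt₀)^{β₂}`
# is unimodular, so the `hext` input of the (17.7) assembly is the plain Ψ₂-sum of `|∫_{𝔍(−1)}𝔨₃*ω|`

Topic `Literature/NumberTheory/LFunctions/Zhang2022` (Landau–Siegel audit tree; verdict-neutral).
Y. Zhang, *Discrete mean estimates and the Landau–Siegel zero*, arXiv:2211.02515v1 (2022)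
[Zhang2022LandauSiegel], §17 (17.7) p. 97 (tex L4770–L4790; "… extend the sum over `Ψ₁` to the sum
over `Ψ` with an acceptable error", the (7.5)/(14.3)/(17.2) method) — an unrefereed manuscript under
adjudication; nothing here asserts or denies its Theorems 1–2 and nothing here is about Landau–Siegel
zeros. ZHANG-L discharge lane, WP16 §17, helper toward the leaf `Typed.Section17.Eq17_9Rel` via the
(17.7) assembly of zl-w16-p7 (`Eq177.eq17_7_of_ext … (hext : …)`; placement W16-S5a (6b) / W14-R3a,
seat zl-w14-p2).

* `norm_sum_PsiTwo_weighted_kfrak3Star_le_of` — the `hext` body of record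
  `‖Σ_{ψ∈Ψ₂}(p_ψt₀)^{β₂}(1/2πi)∫_{𝔍(−1)}𝔨₃*(s,ψ)ω(s)ds‖ ≤ ε𝔓` (every `ε > 0`, all large `D`, under (A))
  FROM the unweighted extension error `Σ_{ψ∈Ψ₂}‖(1/2πi)∫_{𝔍(−1)}𝔨₃*ω‖ ≤ ε𝔓` (stated inline; the
  twin of `Eq172.sum_PsiTwo_norm_segInt_kfrak3_le` with `𝔨₃*`/`𝔍(−1)` for `𝔨₃`/`𝔍(1)`, still to be
  proved), because `|(p_ψt₀)^{β₂}| = 1` (`β₂ ∈ iℝ`, `Typed.Section13.norm_ptcpow_eq_one`).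

No definition, no new claim; the unweighted Ψ₂-sum itself is NOT proved here.

## References

* Y. Zhang, arXiv:2211.02515v1 (2022), §17 (17.7) p.97; §17 (17.2) p.95; §7 (7.5) p.35.
  [cite: Zhang2022LandauSiegel, §17 (17.7) p.97]
-/

noncomputable section

open Complex Real

namespace Literature.NumberTheory.LFunctions.Zhang2022.Eq177

open Skeleton Typed.Section17

/-- **The weighted Ψ₂-extension error of (17.7) from the unweighted one**: since `β₂` is purely
imaginary, `|(p_ψt₀)^{β₂}| = 1`, so `‖Σ_{ψ∈Ψ₂}(p_ψt₀)^{β₂}∫_{𝔍(−1)}𝔨₃*ω‖ ≤ Σ_{ψ∈Ψ₂}‖∫_{𝔍(−1)}𝔨₃*ω‖`;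
hence the `hext` hypothesis of the (17.7) assembly follows from the plain extension estimate.
[cite: Zhang2022LandauSiegel, §17 (17.7) p.97, tex L4770–L4790] -/
theorem norm_sum_PsiTwo_weighted_kfrak3Star_le_of (c' : ℝ)
    (hsum : ∀ ε : ℝ, 0 < ε → ForAllLarge fun D _ χ => AssumptionA D χ →
      ∑ x ∈ finsetOf (PsiTwo χ),
          ‖Lemma81.segInt (t0 D) (ell1 D) (-1) (fun s => kfrak3Star c' χ x s * omegaW D s)‖ ≤
        ε * frakP D) :
    ∀ ε : ℝ, 0 < ε → ForAllLarge fun D _ χ => AssumptionA D χ →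
      ‖∑ x ∈ finsetOf (PsiTwo χ), (((x.p : ℝ) * t0 D : ℝ) : ℂ) ^ beta2 c' D *
          Lemma81.segInt (t0 D) (ell1 D) (-1) (fun s => kfrak3Star c' χ x s * omegaW D s)‖ ≤
        ε * frakP D := by
  intro ε hε
  obtain ⟨D₀, h⟩ := hsum ε hε
  obtain ⟨D₁, hD₁⟩ := exists_nat_forall_le_ell 2
  refine ⟨max D₀ D₁, fun D _ χ hD hq hp hA => ?_⟩
  have hℓ : 1 < ell D := by
    have := hD₁ D (le_trans (le_max_right _ _) hD)
    linarith
  have hmain := h D χ (le_trans (le_max_left _ _) hD) hq hp hA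
  refine (norm_sum_le _ _).trans (le_trans (Finset.sum_le_sum fun x _ => ?_) hmain)
  rw [norm_mul, Typed.Section13.norm_ptcpow_eq_one hℓ x (Typed.Section13.beta2_re c' D), one_mul]

end Literature.NumberTheory.LFunctions.Zhang2022.Eq177
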